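import Literature.IUT.LogVolume.ExplicitEstimatesSzpiroConductorFormExampleProofs
import Literature.NumberTheory.EllipticCurves.LegendreSemistableReductionProofs
import Literature.NumberTheory.DiophantineGeometry.ConductorExponentZeroProofs
import Literature.NumberTheory.DiophantineGeometry.ConductorMultiplicativeProofs
import Literature.NumberTheory.DiophantineGeometry.LocalReductionProofs
import Literature.NumberTheory.DiophantineGeometry.MinimalDiscriminantProofs
import Literature.NumberTheory.DiophantineGeometry.MinimalDiscriminantNormProofs
import HarnessLib

/-!
# [ExpEst] Remark 5.3.3 at `(L, λ) = (ℚ, −9/16)`, I: the CONDUCTOR CERTIFICATE `N(𝔣_{E_λ}) = 15` and the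
# minimal discriminant `N(𝔇_{E_λ}) = 50625 = 3⁴·5⁴`, PROVED over the tree's Ogg/Tate conductor API

S. Mochizuki, I. Fesenko, Y. Hoshi, A. Minamide, W. Porowski, *Explicit estimates in inter-universal
Teichmüller theory*, Kodai Math. J. **45** (2022) 175–236 — [ExpEst], bib key `MochizukiEtAl2022` (claim
key, status disputed) — **Remark 5.3.3**, journal p. 222 l. 14 – p. 223 l. 4 (= pdf p48.l14–p49.l4 of the
cell render `…/abc-iut/plan/repair/lit/renders/MFHMP-ExplicitEstimates-Kodai2022-book-anonnd-eeiutp`).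
PROOF-ONLY sequel of `ExplicitEstimatesSzpiroConductorForm` (which TYPED the remark — nouns
`legendreCondNorm λ = N_{L/ℚ}(𝔣_{E_λ})`, `legendreMinDiscNorm λ = N_{L/ℚ}(𝔇_{E_λ})` over `𝓞 L`; classical inputs
(R1) `Rmk533LocalBound`, (R0) `Rmk533RadLeConductor` as hypothesis predicates; displayed lines (R2)/(R3) as
claim-tagged CANDIDATES) and of `…SzpiroConductorFormExampleProofs` (`E_{−9/16} ≅_ℚ W₀ := ⟨1,1,1,−10,−10⟩`,
`Δ(W₀) = 50625`). No definition, no named fact, no instance. The sequel `…SentencesProofs` evaluates the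
remark's sentences (R0)–(R3) at `(ℚ, −9/16)` from the two numbers certified here.

TAKES NO SIDE on [IUTchIII] Cor. 3.12 or on any author: this is classical arithmetic of ONE elliptic curve
over `ℚ` (Cremona class `15a`) at the point `(L, λ) = (ℚ, −9/16)` of the remark's scope ("In the notation of
Theorem 5.3 [`L` mono-complex], let `λ ∈ L^⑂`", p. 222 l. 14). Typed ≠ proved ≠ endorsed; no abc / Szpiro claim.

PROVED, for `E := ⟨0, −(1+λ), 0, λ, 0⟩`, `λ = −9/16`, over `A = 𝓞 ℚ`, `p_v = natGenerator v` the prime under `v`: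
* §1 reduction (Silverman AEC VII.5.4 (c) as PROVED in the tree's `LegendreSemistableReductionProofs`; AEC
  VII.5.1 (a)): MULTIPLICATIVE at `p_v = 3` (`|λ|_v < 1`) and `p_v = 5` (`|λ−1|_v < 1`), GOOD at every other
  odd place (`|λ|_v = |λ−1|_v = 1`), and GOOD AT `2` through the `ℚ`-isomorphic `ℤ`-model `W₀` of odd
  discriminant (`hasGoodReductionAt_smul_iff_holds`) — although `λ` is NOT `2`-integral (`ord₂ λ = −4`);
* §2 Ogg exponents (the tree's definition of `conductorExponent`; discharged criteria
  `conductorExponent_eq_zero_iff_holds` / `…_eq_one_iff_holds` = ATAEC IV.10.2 (a)(b); residue fields of `ℚ`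
  finite hence perfect): `f_v = 1` at `p_v ∈ {3,5}`, `0` elsewhere; **`𝔣_E = 𝔭₃·𝔭₅`, `legendreCondNorm (−9/16)
  = N(𝔣_E) = 15`**;
* §3 `ord_v(𝔇_min) = 4` at `p_v ∈ {3,5}` (`E` is `v`-integral with `|c₄|_v = |481/256|_v = 1`, hence minimal,
  AEC VII.1 Rmk 1.1; `|Δ|_v = |λ|_v²|λ−1|_v² = p_v^{−4}`, AEC VII.1.3), `0` elsewhere (AEC VII.5.1 (a)); **`𝔇_E =
  𝔭₃⁴·𝔭₅⁴`, `legendreMinDiscNorm (−9/16) = N(𝔇_E) = 50625`** (= `|Δ(W₀)|`, `W₀` a global minimal model).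
Nothing here bears on Thm 5.1, Cor 5.2, Thm 5.3/5.4 of [ExpEst] or on [IUTchIII] Cor. 3.12.
-/

noncomputable section

open NumberField IsDedekindDomain WeierstrassCurve
open Literature.NumberTheory.DiophantineGeometry Literature.NumberTheory.EllipticCurves
open Literature.NumberTheory.DiophantineGeometry.UniformABCConjecture

namespace Literature.IUT.LogVolume

namespace ExpEst

open Cor22 Rat.HeightOneSpectrum

/-! ## 0. Finite places of `ℚ`: valuations of `2, 3, 5, 9, 16, 25, 481, 256` in terms of `p_v` -/

/-- `|n|_v ≤ 1` for a natural number `n` at every finite place `v` of `ℚ`. [folklore] -/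
private theorem valuation_natCast_le_one_rat (v : HeightOneSpectrum (𝓞 ℚ)) (n : ℕ) : v.valuation ℚ (n : ℚ) ≤ 1 := by
  rw [← map_natCast (algebraMap (𝓞 ℚ) ℚ) n]; exact HeightOneSpectrum.valuation_le_one v _

/-- `|n|_v < 1 ⟺ p_v ∣ n` (`p_v = natGenerator v` the prime under `v`). [folklore] -/
private theorem valuation_natCast_lt_one_iff_rat (v : HeightOneSpectrum (𝓞 ℚ)) (n : ℕ) :
    v.valuation ℚ (n : ℚ) < 1 ↔ natGenerator v ∣ n := by
  rw [← map_natCast (algebraMap (𝓞 ℚ) ℚ) n, HeightOneSpectrum.valuation_lt_one_iff_mem,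
    natCast_mem_asIdeal_iff]

/-- `|q^k|_v = 1` unless `p_v = q` (`q` prime). [folklore] -/
private theorem valuation_primePow_eq_one_rat (v : HeightOneSpectrum (𝓞 ℚ)) {q : ℕ} (hq : q.Prime) (k : ℕ)
    (h : natGenerator v ≠ q) : v.valuation ℚ ((q ^ k : ℕ) : ℚ) = 1 :=
  (valuation_natCast_eq_one_iff v _).mpr fun hd =>
    h ((Nat.prime_dvd_prime_iff_eq (prime_natGenerator v) hq).mp ((prime_natGenerator v).dvd_of_dvd_pow hd))

/-- `|2|_v = 1` at every place `v` of `ℚ` not over `2`. [folklore] -/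
private theorem valuation_two_eq_one_rat (v : HeightOneSpectrum (𝓞 ℚ)) (h : natGenerator v ≠ 2) :
    v.valuation ℚ (2 : ℚ) = 1 := by
  have := valuation_primePow_eq_one_rat v Nat.prime_two 1 h; norm_num at this; exact this

/-- `|p_v|_v = p_v^{−1}`: the valuation of the prime under `v` is `exp(−1)`. [folklore] -/
private theorem valuation_natGenerator_rat (v : HeightOneSpectrum (𝓞 ℚ)) :
    v.valuation ℚ ((natGenerator v : ℕ) : ℚ) = WithZero.exp (-1 : ℤ) := by
  rw [← map_natCast (algebraMap (𝓞 ℚ) ℚ), HeightOneSpectrum.valuation_of_algebraMap]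
  exact v.intValuation_singleton (by exact_mod_cast (prime_natGenerator v).ne_zero)
    (asIdeal_eq_span_natGenerator v)

/-- `|λ|_v = |9|_v / |16|_v` for `λ = −9/16`. [folklore] -/
private theorem valuation_nineSixteenths (v : HeightOneSpectrum (𝓞 ℚ)) :
    v.valuation ℚ (-9 / 16 : ℚ) = v.valuation ℚ ((9 : ℕ) : ℚ) / v.valuation ℚ ((16 : ℕ) : ℚ) := by
  rw [show (-9 / 16 : ℚ) = -(((9 : ℕ) : ℚ) / ((16 : ℕ) : ℚ)) by norm_num, Valuation.map_neg, map_div₀]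

/-- `|λ − 1|_v = |25|_v / |16|_v` for `λ = −9/16` (`λ − 1 = −25/16`). [folklore] -/
private theorem valuation_nineSixteenths_sub_one (v : HeightOneSpectrum (𝓞 ℚ)) :
    v.valuation ℚ ((-9 / 16 : ℚ) - 1) = v.valuation ℚ ((25 : ℕ) : ℚ) / v.valuation ℚ ((16 : ℕ) : ℚ) := by
  rw [show (-9 / 16 : ℚ) - 1 = -(((25 : ℕ) : ℚ) / ((16 : ℕ) : ℚ)) by norm_num, Valuation.map_neg, map_div₀]

/-- `|16|_v = 1` off `2`. [folklore] -/
private theorem valuation_sixteen_eq_one_rat (v : HeightOneSpectrum (𝓞 ℚ)) (h : natGenerator v ≠ 2) :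
    v.valuation ℚ ((16 : ℕ) : ℚ) = 1 := valuation_primePow_eq_one_rat v Nat.prime_two 4 h

/-- `|9|_v = 1` off `3`. [folklore] -/
private theorem valuation_nine_eq_one_rat (v : HeightOneSpectrum (𝓞 ℚ)) (h : natGenerator v ≠ 3) :
    v.valuation ℚ ((9 : ℕ) : ℚ) = 1 := valuation_primePow_eq_one_rat v Nat.prime_three 2 h

/-- `|25|_v = 1` off `5`. [folklore] -/
private theorem valuation_twentyFive_eq_one_rat (v : HeightOneSpectrum (𝓞 ℚ)) (h : natGenerator v ≠ 5) :
    v.valuation ℚ ((25 : ℕ) : ℚ) = 1 := valuation_primePow_eq_one_rat v (by norm_num) 2 h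

/-- `|9|_v = 3^{−2}` at the place over `3`. [folklore] -/
private theorem valuation_nine_of_three (v : HeightOneSpectrum (𝓞 ℚ)) (h : natGenerator v = 3) :
    v.valuation ℚ ((9 : ℕ) : ℚ) = WithZero.exp (-1 : ℤ) ^ 2 := by
  rw [show ((9 : ℕ) : ℚ) = ((3 : ℕ) : ℚ) ^ 2 by norm_num, map_pow, ← h, valuation_natGenerator_rat]

/-- `|25|_v = 5^{−2}` at the place over `5`. [folklore] -/
private theorem valuation_twentyFive_of_five (v : HeightOneSpectrum (𝓞 ℚ)) (h : natGenerator v = 5) :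
    v.valuation ℚ ((25 : ℕ) : ℚ) = WithZero.exp (-1 : ℤ) ^ 2 := by
  rw [show ((25 : ℕ) : ℚ) = ((5 : ℕ) : ℚ) ^ 2 by norm_num, map_pow, ← h, valuation_natGenerator_rat]

/-! ## 1. The reduction of `E_{−9/16}` at every finite place of `ℚ` -/

/-- `E_{−9/16}` is an elliptic curve (`λ ≠ 0, 1`; tree `legendre_isElliptic_iff`). A theorem, used via
`haveI`, not an instance. [cite: SilvermanAEC2009, Prop. III.1.7] -/
theorem isElliptic_legendre_nineSixteenths :
    (⟨0, -(1 + (-9 / 16 : ℚ)), 0, -9 / 16, 0⟩ : WeierstrassCurve ℚ).IsElliptic :=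
  (legendre_isElliptic_iff (by norm_num) (-9 / 16 : ℚ)).mpr ⟨by norm_num, by norm_num⟩

/-- **Multiplicative reduction at `3` and at `5`**: `|λ|_3 = 3^{−2} < 1`, resp. `|λ − 1|_5 = |−25/16|_5 =
5^{−2} < 1`, and `|2|_v = 1` (Silverman AEC VII.5.4 (c), case `λ ≡ 0, 1`; tree
`legendre_hasMultiplicativeReductionAt_of_valuation_lt_one` / `…_of_valuation_sub_one_lt_one`).
[cite: SilvermanAEC2009, proof of Prop. VII.5.4(c), Case 2 (PDF p. 176)] -/
theorem hasMultiplicativeReductionAt_nineSixteenths (v : HeightOneSpectrum (𝓞 ℚ))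
    (h : natGenerator v = 3 ∨ natGenerator v = 5) :
    (⟨0, -(1 + (-9 / 16 : ℚ)), 0, -9 / 16, 0⟩ : WeierstrassCurve ℚ).HasMultiplicativeReductionAt v := by
  haveI := isElliptic_legendre_nineSixteenths
  have h2 : natGenerator v ≠ 2 := by rcases h with h | h <;> rw [h] <;> decide
  rcases h with h3 | h5
  · refine legendre_hasMultiplicativeReductionAt_of_valuation_lt_one v (valuation_two_eq_one_rat v h2) ?_
    rw [valuation_nineSixteenths, valuation_sixteen_eq_one_rat v h2, div_one,
      valuation_natCast_lt_one_iff_rat, h3]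
    norm_num
  · refine legendre_hasMultiplicativeReductionAt_of_valuation_sub_one_lt_one v
      (valuation_two_eq_one_rat v h2) ?_
    rw [valuation_nineSixteenths_sub_one, valuation_sixteen_eq_one_rat v h2, div_one,
      valuation_natCast_lt_one_iff_rat, h5]
    norm_num

/-- **Good reduction at `2`**: `E_{−9/16} = C • W₀` with `W₀ = ⟨1, 1, 1, −10, −10⟩` a `ℤ`-model of odd
discriminant `50625` (tree `smul_oddModel_eq_legendre_nineSixteenths`, `Δ_oddModel`), so `W₀` — hence the
`ℚ`-isomorphic `E_{−9/16}` (`hasGoodReductionAt_smul_iff_holds`, AEC VII.1.3 (b)) — has good reduction at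
`2` (AEC VII.5.1 (a); tree `hasGoodReductionAt_of_valuation_le_one_of_valuation_Δ_eq_one`).
[cite: SilvermanAEC2009, VII.5 Prop. 5.1(a)] -/
theorem hasGoodReductionAt_nineSixteenths_two (v : HeightOneSpectrum (𝓞 ℚ)) (h : natGenerator v = 2) :
    (⟨0, -(1 + (-9 / 16 : ℚ)), 0, -9 / 16, 0⟩ : WeierstrassCurve ℚ).HasGoodReductionAt v := by
  rw [← smul_oddModel_eq_legendre_nineSixteenths, hasGoodReductionAt_smul_iff_holds v _ _]
  have h10 : v.valuation ℚ (-10 : ℚ) ≤ 1 := by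
    rw [Valuation.map_neg, show (10 : ℚ) = ((10 : ℕ) : ℚ) by norm_num]
    exact valuation_natCast_le_one_rat v 10
  refine hasGoodReductionAt_of_valuation_le_one_of_valuation_Δ_eq_one v _ (by simp) (by simp) (by simp)
    h10 h10 ?_
  rw [Δ_oddModel, show (50625 : ℚ) = ((50625 : ℕ) : ℚ) by norm_num, valuation_natCast_eq_one_iff, h]
  norm_num

/-- **Good reduction at every place not over `3, 5`**: at `2` by the previous theorem; at an odd place `≠ 3,
5`, `|λ|_v = |λ − 1|_v = 1` (Silverman AEC VII.5.4 (c), case `λ ≢ 0, 1`; tree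
`legendre_hasGoodReductionAt_of_valuation_eq_one`). [cite: SilvermanAEC2009, proof of Prop. VII.5.4(c), Case 1 (PDF p. 176)] -/
theorem hasGoodReductionAt_nineSixteenths (v : HeightOneSpectrum (𝓞 ℚ)) (h3 : natGenerator v ≠ 3)
    (h5 : natGenerator v ≠ 5) :
    (⟨0, -(1 + (-9 / 16 : ℚ)), 0, -9 / 16, 0⟩ : WeierstrassCurve ℚ).HasGoodReductionAt v := by
  by_cases h2 : natGenerator v = 2
  · exact hasGoodReductionAt_nineSixteenths_two v h2
  refine legendre_hasGoodReductionAt_of_valuation_eq_one v (valuation_two_eq_one_rat v h2) ?_ ?_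
  · rw [valuation_nineSixteenths, valuation_sixteen_eq_one_rat v h2, valuation_nine_eq_one_rat v h3, div_one]
  · rw [valuation_nineSixteenths_sub_one, valuation_sixteen_eq_one_rat v h2,
      valuation_twentyFive_eq_one_rat v h5, div_one]

/-! ## 2. Ogg exponents, the conductor ideal `𝔣 = 𝔭₃·𝔭₅`, and `N(𝔣_{E_{−9/16}}) = 15` -/

/-- **The conductor exponents of `E_{−9/16}`**: `f_v = 1` at the places over `3, 5` (multiplicative
reduction, Silverman ATAEC IV.10.2 (b) = tree `conductorExponent_eq_one_iff_holds`), `f_v = 0` at all other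
places (good reduction, ATAEC IV.10.2 (a) = tree `conductorExponent_eq_zero_iff_holds`); the residue
fields of `ℚ` are finite, hence perfect (the standing hypothesis of Tate's algorithm in the tree).
[cite: Silverman1994, IV.10.2(a),(b)] -/
theorem conductorExponent_nineSixteenths (v : HeightOneSpectrum (𝓞 ℚ)) :
    (⟨0, -(1 + (-9 / 16 : ℚ)), 0, -9 / 16, 0⟩ : WeierstrassCurve ℚ).conductorExponent v =
      if natGenerator v = 3 ∨ natGenerator v = 5 then 1 else 0 := by
  haveI := isElliptic_legendre_nineSixteenths
  split_ifs with h
  · exact (conductorExponent_eq_one_iff_holds v _).mpr (hasMultiplicativeReductionAt_nineSixteenths v h)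
  · push Not at h
    exact (conductorExponent_eq_zero_iff_holds v _).mpr (hasGoodReductionAt_nineSixteenths v h.1 h.2)

/-- The prime under the place `primesEquiv.symm p` is `p`. [folklore] -/
private theorem natGenerator_primesEquiv_symm (p : ℕ) (hp : p.Prime) :
    natGenerator ((primesEquiv (R := 𝓞 ℚ)).symm ⟨p, hp⟩) = p :=
  congrArg Subtype.val ((primesEquiv (R := 𝓞 ℚ)).apply_symm_apply ⟨p, hp⟩)

/-- A place with `p_v = p` IS the place `primesEquiv.symm p` (tree `natGenerator_injective`). [folklore] -/
private theorem eq_primesEquiv_symm_of_natGenerator_eq {v : HeightOneSpectrum (𝓞 ℚ)} {p : ℕ} (hp : p.Prime)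
    (h : natGenerator v = p) : v = (primesEquiv (R := 𝓞 ℚ)).symm ⟨p, hp⟩ :=
  natGenerator_injective (h.trans (natGenerator_primesEquiv_symm p hp).symm)

/-- A `finprod` of prime-ideal powers `𝔭_v^{g(p_v)}` whose exponent vanishes off `p_v ∈ {3, 5}` is the
finite product `𝔭₃^{g 3} · 𝔭₅^{g 5}` (plumbing shared by the conductor and the minimal discriminant).
[folklore] -/
private theorem finprod_pow_eq_of_support_three_five (g : ℕ → ℕ) (hg : ∀ p, p ≠ 3 → p ≠ 5 → g p = 0) :
    ∏ᶠ v : HeightOneSpectrum (𝓞 ℚ), v.asIdeal ^ g (natGenerator v) =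
      ((primesEquiv (R := 𝓞 ℚ)).symm ⟨3, Nat.prime_three⟩).asIdeal ^ g 3 *
        ((primesEquiv (R := 𝓞 ℚ)).symm ⟨5, by norm_num⟩).asIdeal ^ g 5 := by
  classical
  set v₃ := (primesEquiv (R := 𝓞 ℚ)).symm ⟨3, Nat.prime_three⟩ with hv₃
  set v₅ := (primesEquiv (R := 𝓞 ℚ)).symm ⟨5, by norm_num⟩ with hv₅
  have hsub : (Function.mulSupport fun v : HeightOneSpectrum (𝓞 ℚ) => v.asIdeal ^ g (natGenerator v)) ⊆
      ↑({v₃, v₅} : Finset (HeightOneSpectrum (𝓞 ℚ))) := by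
    intro v hv
    rw [Function.mem_mulSupport] at hv
    have hne : g (natGenerator v) ≠ 0 := fun h0 => hv (by rw [h0, pow_zero])
    by_cases h3 : natGenerator v = 3
    · simp [eq_primesEquiv_symm_of_natGenerator_eq Nat.prime_three h3, hv₃]
    · by_cases h5 : natGenerator v = 5
      · simp [eq_primesEquiv_symm_of_natGenerator_eq (by norm_num : Nat.Prime 5) h5, hv₅]
      · exact absurd (hg _ h3 h5) hne
  have hne : v₃ ≠ v₅ := fun h => absurd (congrArg natGenerator h) (by
    rw [hv₃, hv₅, natGenerator_primesEquiv_symm, natGenerator_primesEquiv_symm]; decide)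
  rw [finprod_eq_prod_of_mulSupport_subset _ hsub, Finset.prod_pair hne, hv₃, hv₅,
    natGenerator_primesEquiv_symm, natGenerator_primesEquiv_symm]

/-- **The conductor ideal of `E_{−9/16}` over `ℚ` is `𝔭₃ · 𝔭₅`** (`𝔣 = ∏ 𝔭_v^{f_v}`, Silverman ATAEC IV.10,
with the exponents of `conductorExponent_nineSixteenths`). [cite: Silverman1994, §IV.10 (Definition preceding Example 10.5)] -/
theorem conductor_nineSixteenths :
    (⟨0, -(1 + (-9 / 16 : ℚ)), 0, -9 / 16, 0⟩ : WeierstrassCurve ℚ).conductor (𝓞 ℚ) =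
      ((primesEquiv (R := 𝓞 ℚ)).symm ⟨3, Nat.prime_three⟩).asIdeal *
        ((primesEquiv (R := 𝓞 ℚ)).symm ⟨5, by norm_num⟩).asIdeal := by
  have h := finprod_pow_eq_of_support_three_five (fun p => if p = 3 ∨ p = 5 then 1 else 0)
    (fun p h3 h5 => by simp [h3, h5])
  simp only [← conductorExponent_nineSixteenths] at h
  rw [WeierstrassCurve.conductor, h]
  norm_num

/-- **The conductor certificate: `N_{ℚ/ℚ}(𝔣_{E_{−9/16}}) = 15`**, i.e. `legendreCondNorm (−9/16 : ℚ) = 15`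
(`N(𝔭₃)·N(𝔭₅) = 3·5`; `N(𝔭_v) = p_v`, tree `absNorm_asIdeal_eq_natGenerator`). Cremona label `15a`
isogeny class (the `ℤ`-model `⟨1,1,1,−10,−10⟩` is `15a1`). [cite: Silverman1994, §IV.10 (Definition preceding Example 10.5)] -/
theorem legendreCondNorm_nineSixteenths : legendreCondNorm (-9 / 16 : ℚ) = 15 := by
  rw [legendreCondNorm_def, WeierstrassCurve.conductorNorm, conductor_nineSixteenths, map_mul,
    UniformABCConjecture.absNorm_asIdeal_eq_natGenerator,
    UniformABCConjecture.absNorm_asIdeal_eq_natGenerator, natGenerator_primesEquiv_symm,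
    natGenerator_primesEquiv_symm]

/-! ## 3. `ord_v(𝔇_min)`, the minimal discriminant ideal `𝔇 = 𝔭₃⁴·𝔭₅⁴`, and `N(𝔇_{E_{−9/16}}) = 50625` -/

/-- At the places over `3` and `5` the Legendre equation of `λ = −9/16` is `v`-integral with `|c₄|_v =
|16(λ² − λ + 1)|_v = |481/256|_v = 1`, hence MINIMAL at `v` (Silverman AEC VII.1 Rmk 1.1, tree
`isMinimalAt_of_lt_valuation_c₄`). [cite: SilvermanAEC2009, VII.1 Remark 1.1] -/
theorem isMinimalAt_nineSixteenths (v : HeightOneSpectrum (𝓞 ℚ)) (h : natGenerator v = 3 ∨ natGenerator v = 5) :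
    (⟨0, -(1 + (-9 / 16 : ℚ)), 0, -9 / 16, 0⟩ : WeierstrassCurve ℚ).IsMinimalAt v := by
  have h2 : natGenerator v ≠ 2 := by rcases h with h | h <;> rw [h] <;> decide
  have hint : (⟨0, -(1 + (-9 / 16 : ℚ)), 0, -9 / 16, 0⟩ : WeierstrassCurve ℚ).IsIntegralAt v := by
    refine legendre_isIntegralAt_of_valuation_le_one v ?_
    rw [valuation_nineSixteenths, valuation_sixteen_eq_one_rat v h2, div_one]
    exact valuation_natCast_le_one_rat v 9
  refine isMinimalAt_of_lt_valuation_c₄ hint ?_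
  have h481 : v.valuation ℚ ((481 : ℕ) : ℚ) = 1 :=
    (valuation_natCast_eq_one_iff v _).mpr (by rcases h with h | h <;> rw [h] <;> norm_num)
  have h256 : v.valuation ℚ ((256 : ℕ) : ℚ) = 1 := valuation_primePow_eq_one_rat v Nat.prime_two 8 h2
  rw [valuation_legendre_c₄ v (valuation_two_eq_one_rat v h2),
    show (-9 / 16 : ℚ) ^ 2 - (-9 / 16) + 1 = ((481 : ℕ) : ℚ) / ((256 : ℕ) : ℚ) by norm_num, map_div₀, h481,
    h256, div_one, ← WithZero.exp_zero]
  exact WithZero.exp_lt_exp.mpr (by norm_num)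

/-- **`ord_v(𝔇_min(E_{−9/16}))`**: `4` at the places over `3` and `5` (minimal equation with `|Δ|_v = |λ|_v²·
|λ − 1|_v² = p_v^{−4}`, AEC VII.1 Prop. 1.3 = tree `valuation_Δ_eq_of_isMinimalAt_holds`), `0` at every
other place (good reduction, AEC VII.5.1 (a) = tree `ordMinimalDiscriminant_eq_zero_iff_holds`).
[cite: SilvermanAEC2009, VII.1 Prop. 1.3 and VII.5 Prop. 5.1(a)] -/
theorem ordMinimalDiscriminant_nineSixteenths (v : HeightOneSpectrum (𝓞 ℚ)) :
    (⟨0, -(1 + (-9 / 16 : ℚ)), 0, -9 / 16, 0⟩ : WeierstrassCurve ℚ).ordMinimalDiscriminant v =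
      if natGenerator v = 3 ∨ natGenerator v = 5 then 4 else 0 := by
  haveI := isElliptic_legendre_nineSixteenths
  split_ifs with h
  · have h2 : natGenerator v ≠ 2 := by rcases h with h | h <;> rw [h] <;> decide
    have hΔ := valuation_Δ_eq_of_isMinimalAt_holds v _ (isMinimalAt_nineSixteenths v h)
    rw [valuation_legendre_Δ v (valuation_two_eq_one_rat v h2), valuation_nineSixteenths,
      valuation_nineSixteenths_sub_one, valuation_sixteen_eq_one_rat v h2, div_one, div_one] at hΔ
    have h4 : v.valuation ℚ ((9 : ℕ) : ℚ) ^ 2 * v.valuation ℚ ((25 : ℕ) : ℚ) ^ 2 =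
        WithZero.exp (-(4 : ℕ) : ℤ) := by
      rcases h with h3 | h5
      · rw [valuation_nine_of_three v h3, valuation_twentyFive_eq_one_rat v (by rw [h3]; decide), one_pow,
          mul_one, ← pow_mul, ← WithZero.exp_nsmul]
        norm_num
      · rw [valuation_twentyFive_of_five v h5, valuation_nine_eq_one_rat v (by rw [h5]; decide), one_pow,
          one_mul, ← pow_mul, ← WithZero.exp_nsmul]
        norm_num
    rw [h4, WithZero.exp_inj, neg_inj] at hΔ
    exact_mod_cast hΔ.symm
  · push Not at h
    exact (ordMinimalDiscriminant_eq_zero_iff_holds v _).mpr (hasGoodReductionAt_nineSixteenths v h.1 h.2)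

/-- **The minimal discriminant ideal of `E_{−9/16}` over `ℚ` is `𝔭₃⁴ · 𝔭₅⁴`** (`𝔇_min = ∏ 𝔭_v^{ord_v(Δ_min)}`,
Silverman AEC VIII.8). [cite: SilvermanAEC2009, VIII.8] -/
theorem minimalDiscriminantIdeal_nineSixteenths :
    (⟨0, -(1 + (-9 / 16 : ℚ)), 0, -9 / 16, 0⟩ : WeierstrassCurve ℚ).minimalDiscriminantIdeal (𝓞 ℚ) =
      ((primesEquiv (R := 𝓞 ℚ)).symm ⟨3, Nat.prime_three⟩).asIdeal ^ 4 *
        ((primesEquiv (R := 𝓞 ℚ)).symm ⟨5, by norm_num⟩).asIdeal ^ 4 := by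
  have h := finprod_pow_eq_of_support_three_five (fun p => if p = 3 ∨ p = 5 then 4 else 0)
    (fun p h3 h5 => by simp [h3, h5])
  simp only [← ordMinimalDiscriminant_nineSixteenths] at h
  rw [WeierstrassCurve.minimalDiscriminantIdeal, h]
  norm_num

/-- **`N_{ℚ/ℚ}(𝔇_{E_{−9/16}}) = 50625 = 3⁴·5⁴`**, i.e. `legendreMinDiscNorm (−9/16 : ℚ) = 50625` (= `|Δ(W₀)|`
for the global minimal model `W₀ = ⟨1,1,1,−10,−10⟩`, consistent with `Δ_oddModel`). [cite: SilvermanAEC2009, VIII.8] -/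
theorem legendreMinDiscNorm_nineSixteenths : legendreMinDiscNorm (-9 / 16 : ℚ) = 50625 := by
  rw [legendreMinDiscNorm_def, WeierstrassCurve.minimalDiscriminantNorm, minimalDiscriminantIdeal_nineSixteenths,
    map_mul, map_pow, map_pow, UniformABCConjecture.absNorm_asIdeal_eq_natGenerator,
    UniformABCConjecture.absNorm_asIdeal_eq_natGenerator,
    natGenerator_primesEquiv_symm, natGenerator_primesEquiv_symm]
  norm_num

end ExpEst

end Literature.IUT.LogVolume
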